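import Summits.BirchSwinnertonDyer.Rank1Residual.X10.SelmerCompanionsTamagawaFree
import HarnessLib

/-!
# The RANK–Ш EXCHANGE LAW along Tamagawa-free congruences: `p^{rank E′} · #Ш(E′)[p] = p^{rank E} · #Ш(E)[p]`
# — visibility of `Ш[p]` from a partner's rank with NO local kinds and NO Tate uniformisation
# (cell `b2b-bsdres`, unit `b2b-bsdres-x10` = N2 class lead, GEN 29; TOOL — theorems only, no
# definition, no named fact of its own, nothing booked)

HONEST FRAMING (run/shared/lean/b2b/bsd-rank1-residual/, verbatim in every file): the goal of the
cell is to DELETE the COMBINATION-SHAPED residual classes of the Birch–Swinnerton-Dyer formula for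
ALL analytic-rank `≤ 1` elliptic curves over `ℚ` — "full BSD formula for every rank `≤ 1` curve in
class `C`" assembled STRICTLY from published theorems — so that the rank-`≤ 1` remainder becomes
exactly the CONSTRUCTION-SHAPED classes, which are TYPED (missing-input `Prop`s), NOT attempted.
This is not "finishing BSD". Class X10b (= N2) keeps its label CONSTRUCTION-SHAPED (NEEDS `X_A3`,
referee R82.3 / RESIDUAL-MAP §I N2); this file is a TOOL; no mark / label / tier / count moves.

## What

`X10/SelmerCompanionsTamagawaFree.lean` (x10 GEN 29) gives `#Sel^(p)(E′/ℚ) = #Sel^(p)(E/ℚ)` for a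
`Γ_ℚ`-isomorphism `θ : E′[p] ⥲ E[p]` (`p` odd), both curves good at `p`, `p ∤ Tam(E)`, `p ∤ Tam(E′)`
(Mazur–Rubin 2015 at `p` = named fact `hMR`; Milne I.3.8 off `p` = n1011's row T-URTAM). Feeding both
sides into the exact descent count `#Sel^(p) = p^{rank} · #E(ℚ)[p] · #Ш[p]` (Silverman X.4.2, tree
`natCard_selmerGroup_eq`), with `E(ℚ)[p] = E′(ℚ)[p] = 0` (irreducibility of `E[p]`, transported to
`E′[p]` along `θ`), gives

* **`pow_rank_mul_natCard_sha_torsion_eq_of_congr_rat`** —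
  **`p^{rank E′(ℚ)} · #Ш(E′/ℚ)[p] = p^{rank E(ℚ)} · #Ш(E/ℚ)[p]`**: along a Tamagawa-free congruence,
  rank is traded against `Ш[p]` at par;
* `natCard_sha_torsion_eq_pow_rank_mul_of_congr_of_rank_zero_rat` — if `rank E(ℚ) = 0`:
  `#Ш(E/ℚ)[p] = p^{rank E′(ℚ)} · #Ш(E′/ℚ)[p]`, so `p^{rank E′(ℚ)} ∣ #Ш(E/ℚ)[p]`
  (`pow_rank_dvd_natCard_sha_torsion_of_congr_of_rank_zero_rat`) and `Ш(E/ℚ)[p] ≠ 0` as soon as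
  `rank E′(ℚ) ≥ 1` (`exists_sha_ne_zero_of_congr_of_rank_pos_rat`);
* the general-field count behind it (`pow_rank_mul_natCard_sha_torsion_eq_of_natCard_selmerGroup_eq`,
  any number field, fact-free: equal Selmer counts and no rational `p`-torsion on either side).

VISIBILITY COMPARISON. The cell's visibility records (Cremona–Mazur / Agashe–Stein shape,
`exists_sha_ne_zero_of_congr_of_le_off`, n1011 `Visible.*`, x10 GEN 21–23 `SelfTwistVisible*`) bound
`#Ш(E)[p]` from BELOW by `p^{rank E′}/∏ ι_v(θ)` and pay for each bad place with a local KIND (good /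
additive torsion-free / non-split / multiplicative of the same twist class below the Tate-uniformisation
named facts `hU`, `hU2` / the place `p` PAID or FREE). At Tamagawa-free level NO kind is needed: every
place `v ≠ p` with `p ∤ c_v(E) c_v(E′)` is free by (L1), whatever the reduction types, and the count is an
EQUALITY. N2 reading (`p = 3`): the three Ш-cells with a rank-`2` self-twist in Cremona's table —
`288800ba1 ~ 288800cd1`, `305762d1 ~ 305762c1`, `322624k1 ~ 322624i1` (all six curves good at `3` with
`Tam ∈ {4, 8}`) — get `9 ∣ #Ш(E)[3]` below `hMR` alone (records: `X10/RankShaExchangeRecords.lean`),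
where GEN 21's records needed `hU`, `hU2` for the multiplicative place `2`.

All statements CONDITIONAL on `hMR` (Mazur–Rubin 2015 Thm. 3.1 (iv)(b)); `θ` and the ranks are
displayed. Nothing booked; no count of record moves.

## References

* [MazurRubin2015SelmerCompanions] B. Mazur, K. Rubin, *Selmer companion curves*, TAMS 367 (2015), Thm. 3.1.
* [CremonaMazur2000] J. E. Cremona, B. Mazur, *Visualizing elements in the Shafarevich–Tate group*,
  Experiment. Math. 9 (2000), §3.
* [MilneADT2006] J. S. Milne, *Arithmetic Duality Theorems*, 2nd ed., I Prop. 3.8, Rem. 3.10.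
* [SilvermanAEC2009] J. H. Silverman, *AEC*, Thm. X.4.2.
* HOME/class-closure/N2/TRIVIAL-ROADS-x10g27.md §3 (NOGO-sha row); HOME/X10-AUDIT.md §35.
-/

set_option autoImplicit false

noncomputable section

open scoped Classical

open WeierstrassCurve Literature.NumberTheory.EllipticCurves
  Literature.NumberTheory.GaloisRepresentations Field NumberField IsDedekindDomain
open Literature.NumberTheory.EllipticCurves.MazurRubin2015
open Summit.BirchSwinnertonDyer.Rank1Residual.X10.SelmerCompanionsTamagawaFree

namespace Summit.BirchSwinnertonDyer.Rank1Residual.X10.RankShaExchange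

/-! ### §1. The count (any number field; fact-free) -/

section General

variable {K : Type} [Field K] [NumberField K] (W W' : WeierstrassCurve K) [W.IsElliptic]
  [W'.IsElliptic] {p : ℕ} [hp : Fact p.Prime]

/-- **Rank–Ш exchange from equal Selmer counts.** For elliptic curves `E = W`, `E′ = W′` over a number
field `K` and a prime `p` with `#Sel^(p)(E′/K) = #Sel^(p)(E/K)` and no `K`-rational `p`-torsion on
either side: `p^{rank E′(K)} · #Ш(E′/K)[p] = p^{rank E(K)} · #Ш(E/K)[p]` — both sides are the common
Selmer count (Silverman X.4.2: `#Sel^(p) = p^{rank} · #E(K)[p] · #Ш[p]`, tree `natCard_selmerGroup_eq`).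
Fact-free. [cite: SilvermanAEC2009, Thm. X.4.2] -/
theorem pow_rank_mul_natCard_sha_torsion_eq_of_natCard_selmerGroup_eq
    (hSel : Nat.card (W'.selmerGroup (p : ℤ)) = Nat.card (W.selmerGroup (p : ℤ)))
    (htors : Nat.card (AddSubgroup.torsionBy W.toAffine.Point (p : ℤ)) = 1)
    (htors' : Nat.card (AddSubgroup.torsionBy W'.toAffine.Point (p : ℤ)) = 1) :
    p ^ W'.mordellWeilRank *
        Nat.card (W'.sha ⊓ AddSubgroup.torsionBy W'.galH1 (p : ℤ) : AddSubgroup W'.galH1) =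
      p ^ W.mordellWeilRank *
        Nat.card (W.sha ⊓ AddSubgroup.torsionBy W.galH1 (p : ℤ) : AddSubgroup W.galH1) := by
  have h := W.natCard_selmerGroup_eq hp.out.ne_zero
  have h' := W'.natCard_selmerGroup_eq hp.out.ne_zero
  rw [htors, mul_one] at h
  rw [htors', mul_one] at h'
  rw [← h, ← h', hSel]

end General

/-! ### §2. Along a Tamagawa-free congruence over `ℚ` (both curves good at `p`; `hMR`) -/

section Rat

variable (W W' : WeierstrassCurve ℚ) [W.IsElliptic] [W'.IsElliptic] {p : ℕ} [hp : Fact p.Prime]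

/-- **THE RANK–Ш EXCHANGE LAW.** `p` an odd prime; `θ : E′[p] ⥲ E[p]` a `Γ_ℚ`-isomorphism; both
curves good at `p`; `p ∤ Tam(E)`, `p ∤ Tam(E′)`; `E[p]` irreducible (hence `E′[p]` is, and
`E(ℚ)[p] = E′(ℚ)[p] = 0`). Then **`p^{rank E′(ℚ)} · #Ш(E′/ℚ)[p] = p^{rank E(ℚ)} · #Ш(E/ℚ)[p]`**:
(C-i) `#Sel^(p)(E′) = #Sel^(p)(E)` + Silverman X.4.2 on both sides. CONDITIONAL on `hMR`.
[cite: MazurRubin2015SelmerCompanions, Thm. 3.1 (iv)(b)] [cite: MilneADT2006, Ch. I Prop. 3.8 and Remark 3.10]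
[cite: SilvermanAEC2009, Thm. X.4.2] -/
theorem pow_rank_mul_natCard_sha_torsion_eq_of_congr_rat
    (hMR : selmerLocalKer_iff_of_goodReduction_above) (hp2 : p ≠ 2)
    (θ : geomTorsion W' (p : ℤ) ≃+ geomTorsion W (p : ℤ))
    (hθ : ∀ (σ : absoluteGaloisGroup ℚ) (P : geomTorsion W' (p : ℤ)), θ (σ • P) = σ • θ P)
    (hgood : ∀ v : HeightOneSpectrum (𝓞 ℚ), (p : 𝓞 ℚ) ∈ v.asIdeal →
      W.HasGoodReductionAt v ∧ W'.HasGoodReductionAt v)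
    (htam : ¬ p ∣ W.tamagawaProduct) (htam' : ¬ p ∣ W'.tamagawaProduct)
    (hirr : W.HasIrreducibleModPGaloisRep p) :
    p ^ W'.mordellWeilRank *
        Nat.card (W'.sha ⊓ AddSubgroup.torsionBy W'.galH1 (p : ℤ) : AddSubgroup W'.galH1) =
      p ^ W.mordellWeilRank *
        Nat.card (W.sha ⊓ AddSubgroup.torsionBy W.galH1 (p : ℤ) : AddSubgroup W.galH1) := by
  have hirr' : W'.HasIrreducibleModPGaloisRep p :=
    Mazur1978.hasIrreducibleModPGaloisRep_of_addEquiv θ.symm (symm_equivariant θ hθ) hirr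
  -- `E(ℚ)[p] = E′(ℚ)[p] = 0` (`ℚ`'s decidable equality vs the classical one: `convert`)
  exact pow_rank_mul_natCard_sha_torsion_eq_of_natCard_selmerGroup_eq W W'
    (natCard_selmerGroup_eq_of_congr_of_not_dvd_tamagawaProduct_rat W W' hMR hp2 θ hθ hgood htam htam')
    (by convert natCard_torsionBy_eq_one_of_hasIrreducibleModPGaloisRep W p hirr)
    (by convert natCard_torsionBy_eq_one_of_hasIrreducibleModPGaloisRep W' p hirr')

/-- **Rank of the partner as `Ш` of the rank-`0` curve.** Under the hypotheses of the exchange law,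
if `rank E(ℚ) = 0` then **`#Ш(E/ℚ)[p] = p^{rank E′(ℚ)} · #Ш(E′/ℚ)[p]`**. CONDITIONAL on `hMR`.
[cite: MazurRubin2015SelmerCompanions, Thm. 3.1 (iv)(b)] [cite: SilvermanAEC2009, Thm. X.4.2] -/
theorem natCard_sha_torsion_eq_pow_rank_mul_of_congr_of_rank_zero_rat
    (hMR : selmerLocalKer_iff_of_goodReduction_above) (hp2 : p ≠ 2)
    (θ : geomTorsion W' (p : ℤ) ≃+ geomTorsion W (p : ℤ))
    (hθ : ∀ (σ : absoluteGaloisGroup ℚ) (P : geomTorsion W' (p : ℤ)), θ (σ • P) = σ • θ P)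
    (hgood : ∀ v : HeightOneSpectrum (𝓞 ℚ), (p : 𝓞 ℚ) ∈ v.asIdeal →
      W.HasGoodReductionAt v ∧ W'.HasGoodReductionAt v)
    (htam : ¬ p ∣ W.tamagawaProduct) (htam' : ¬ p ∣ W'.tamagawaProduct)
    (hirr : W.HasIrreducibleModPGaloisRep p) (hrank : W.mordellWeilRank = 0) :
    Nat.card (W.sha ⊓ AddSubgroup.torsionBy W.galH1 (p : ℤ) : AddSubgroup W.galH1) =
      p ^ W'.mordellWeilRank *
        Nat.card (W'.sha ⊓ AddSubgroup.torsionBy W'.galH1 (p : ℤ) : AddSubgroup W'.galH1) := by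
  have h := pow_rank_mul_natCard_sha_torsion_eq_of_congr_rat W W' hMR hp2 θ hθ hgood htam htam' hirr
  rw [hrank, pow_zero, one_mul] at h
  exact h.symm

/-- **Visibility at Tamagawa-free level, divisibility form**: `rank E(ℚ) = 0` ⟹
`p^{rank E′(ℚ)} ∣ #Ш(E/ℚ)[p]` — no local kinds, no Tate uniformisation; CONDITIONAL on `hMR` only.
N2 reading: a Ш-cell with a rank-`2` Tamagawa-`3`-free good-at-`3` congruent partner has `9 ∣ #Ш(E)[3]`.
[cite: MazurRubin2015SelmerCompanions, Thm. 3.1 (iv)(b)] [cite: CremonaMazur2000, §3]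
[cite: SilvermanAEC2009, Thm. X.4.2] -/
theorem pow_rank_dvd_natCard_sha_torsion_of_congr_of_rank_zero_rat
    (hMR : selmerLocalKer_iff_of_goodReduction_above) (hp2 : p ≠ 2)
    (θ : geomTorsion W' (p : ℤ) ≃+ geomTorsion W (p : ℤ))
    (hθ : ∀ (σ : absoluteGaloisGroup ℚ) (P : geomTorsion W' (p : ℤ)), θ (σ • P) = σ • θ P)
    (hgood : ∀ v : HeightOneSpectrum (𝓞 ℚ), (p : 𝓞 ℚ) ∈ v.asIdeal →
      W.HasGoodReductionAt v ∧ W'.HasGoodReductionAt v)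
    (htam : ¬ p ∣ W.tamagawaProduct) (htam' : ¬ p ∣ W'.tamagawaProduct)
    (hirr : W.HasIrreducibleModPGaloisRep p) (hrank : W.mordellWeilRank = 0) :
    p ^ W'.mordellWeilRank ∣
      Nat.card (W.sha ⊓ AddSubgroup.torsionBy W.galH1 (p : ℤ) : AddSubgroup W.galH1) :=
  Dvd.intro _ (natCard_sha_torsion_eq_pow_rank_mul_of_congr_of_rank_zero_rat W W' hMR hp2 θ hθ hgood
    htam htam' hirr hrank).symm

/-- **Visibility at Tamagawa-free level, element form**: `rank E(ℚ) = 0` and `rank E′(ℚ) ≥ 1` ⟹ there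
is `c ∈ Ш(E/ℚ)`, `c ≠ 0`, `p • c = 0` (the shape of the cell's visibility records). CONDITIONAL on `hMR`.
[cite: MazurRubin2015SelmerCompanions, Thm. 3.1 (iv)(b)] [cite: CremonaMazur2000, §3] -/
theorem exists_sha_ne_zero_of_congr_of_rank_pos_rat
    (hMR : selmerLocalKer_iff_of_goodReduction_above) (hp2 : p ≠ 2)
    (θ : geomTorsion W' (p : ℤ) ≃+ geomTorsion W (p : ℤ))
    (hθ : ∀ (σ : absoluteGaloisGroup ℚ) (P : geomTorsion W' (p : ℤ)), θ (σ • P) = σ • θ P)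
    (hgood : ∀ v : HeightOneSpectrum (𝓞 ℚ), (p : 𝓞 ℚ) ∈ v.asIdeal →
      W.HasGoodReductionAt v ∧ W'.HasGoodReductionAt v)
    (htam : ¬ p ∣ W.tamagawaProduct) (htam' : ¬ p ∣ W'.tamagawaProduct)
    (hirr : W.HasIrreducibleModPGaloisRep p) (hrank : W.mordellWeilRank = 0)
    (hrank' : 1 ≤ W'.mordellWeilRank) :
    ∃ c : W.sha, c ≠ 0 ∧ p • c = 0 := by
  have hpp : p.Prime := hp.out
  set G : AddSubgroup W.galH1 := W.sha ⊓ AddSubgroup.torsionBy W.galH1 (p : ℤ) with hG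
  have hdvd : p ∣ Nat.card G :=
    (dvd_pow_self p (Nat.one_le_iff_ne_zero.mp hrank')).trans
      (pow_rank_dvd_natCard_sha_torsion_of_congr_of_rank_zero_rat W W' hMR hp2 θ hθ hgood htam htam'
        hirr hrank)
  -- `#G ≠ 1`, so `G` has a non-zero element
  have hne : Nat.card G ≠ 1 := fun h1 ↦ hpp.one_lt.ne' (Nat.dvd_one.mp (h1 ▸ hdvd))
  have hnt : ∃ g : G, g ≠ 0 := by
    by_contra hall
    push Not at hall
    haveI : Subsingleton G := ⟨fun a b ↦ by rw [hall a, hall b]⟩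
    exact hne (Nat.card_of_subsingleton (0 : G))
  obtain ⟨g, hg⟩ := hnt
  have hgsha : (g : W.galH1) ∈ W.sha := (AddSubgroup.mem_inf.mp g.2).1
  have hgtor : p • (g : W.galH1) = 0 :=
    AddSubgroup.torsionBy.nsmul_iff.mp (AddSubgroup.mem_inf.mp g.2).2
  refine ⟨⟨(g : W.galH1), hgsha⟩, fun h0 ↦ hg (Subtype.ext ?_), Subtype.ext ?_⟩
  · have h := congrArg (fun c : W.sha ↦ (c : W.galH1)) h0
    simpa using h
  · rw [AddSubgroupClass.coe_nsmul, ZeroMemClass.coe_zero]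
    exact hgtor

end Rat

end Summit.BirchSwinnertonDyer.Rank1Residual.X10.RankShaExchange

end
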